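import Mathlib

/-!
# Cancelling-curve filter (solo-informed s39, door D1 for HKM24 Q1.4)

The cancelling-disc criterion (work/s39/destab2.md, Prop DESTAB-2): a curve `c` on the genus-2
surface `∂H = T_b ♮ h(τ)` crossing the belt circle once, primitive in `H`, bounding a framed disc off
`E(3₁) × 0`, unknots `T_b`.  Writing such a disc as a planar surface in `Σ(2,3,7)° × I` plus
`n₊ + n₋` cores of the 2-handle `ĉ`, the framing condition reads, in `S³`-terms,
`sf_{S³}(c) = ℓ · (2σN − ℓ)` with `ℓ = lk(c, 3₁)`, `N = n₊ − n₋`, `σ = ±1`, i.e.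
`sf = ℓ * (2 * N - ℓ) ∨ sf = ℓ * (-2 * N - ℓ)`.
We certify the elementary consequences used in destab2.md §4–§5:
* parity: `sf_{S³}(c) ≡ ℓ (mod 2)`;  `N = 0` forces `sf = -ℓ²`;
* the three single-torus candidates `(sf, ℓ) = (1, ±2), (1, ±3), (2, ±3)` violate the condition for
  every `N`, so every cancelling curve crosses the separating meridian `∂D_A` of `H`.
-/

namespace Summit.SmoothPoincare4.SmoothPoincare4.Theorems

/-- Parity consequence of the framing condition (F): `sf_{S³}(c) ≡ ℓ (mod 2)`. -/
theorem cancellingFraming_parity (sf ℓ N : ℤ)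
    (h : sf = ℓ * (2 * N - ℓ) ∨ sf = ℓ * (-2 * N - ℓ)) : (2 : ℤ) ∣ sf - ℓ := by
  obtain ⟨r, hr⟩ := Int.even_mul_succ_self ℓ
  rcases h with h | h
  · exact ⟨N * ℓ - r, by subst h; linear_combination (-1 : ℤ) * hr⟩
  · exact ⟨-N * ℓ - r, by subst h; linear_combination (-1 : ℤ) * hr⟩

/-- `N = 0` (as many positive as negative passages over the 2-handle) forces `sf = -ℓ²`. -/
theorem cancellingFraming_zero (sf ℓ : ℤ)
    (h : sf = ℓ * (2 * 0 - ℓ) ∨ sf = ℓ * (-2 * 0 - ℓ)) : sf = -ℓ ^ 2 := by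
  rcases h with h | h <;> subst h <;> ring

/-- The three single-torus candidates of destab2.md §5 (`σ ⊂ T₁°`, `σ ⊂ T₂°`, `2l+m ⊂ T₂°`, with
`(sf_{S³}, ℓ) = (1, ±2), (1, ±3), (2, ±3)`) violate the framing condition for every `N`. -/
theorem singleTorusCandidates_obstructed (N : ℤ) :
    ¬ ((1 : ℤ) = 2 * (2 * N - 2) ∨ (1 : ℤ) = 2 * (-2 * N - 2)) ∧
    ¬ ((1 : ℤ) = -2 * (2 * N - -2) ∨ (1 : ℤ) = -2 * (-2 * N - -2)) ∧
    ¬ ((1 : ℤ) = 3 * (2 * N - 3) ∨ (1 : ℤ) = 3 * (-2 * N - 3)) ∧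
    ¬ ((1 : ℤ) = -3 * (2 * N - -3) ∨ (1 : ℤ) = -3 * (-2 * N - -3)) ∧
    ¬ ((2 : ℤ) = 3 * (2 * N - 3) ∨ (2 : ℤ) = 3 * (-2 * N - 3)) ∧
    ¬ ((2 : ℤ) = -3 * (2 * N - -3) ∨ (2 : ℤ) = -3 * (-2 * N - -3)) := by
  omega

/-- By contrast the condition alone does not exclude `|N| = 1`: `(sf, ℓ, N) = (1, 1, 1)` satisfies it
(the exclusion of a single passage is the trace computation of destab2.md §4 (T), not the framing). -/
theorem cancellingFraming_N_one_example : (1 : ℤ) = 1 * (2 * 1 - 1) := by norm_num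

end Summit.SmoothPoincare4.SmoothPoincare4.Theorems
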